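import Summits.QuantumFields.YangMills.Theorems.BalabanUVNodesN16Eq42PermutationDefectAbelian
import HarnessLib

/-!
# YM-DAG node N16 (NE3), the located averaging pin (42) ↔ (0.4) — part 4: (42) AGAINST THE (0.4)-SHAPED SYMMETRISED RECIPE AT FIRST
# ORDER: the symmetrised linear exponent IS the REYNOLDS AVERAGE of (42)'s over the axis permutations; hence it is EXACTLY
# permutation-equivariant, EQUAL to (42)'s at constant curvature, and within `d(d+2)L³δ` of it on Lipschitz-flux fields

Cell `pub-ymgap`, width seat `pub-ymgap-dag-n16-w3` (director-ym №197 ∕ HUMAN RULING D-0149), generation 2; part 4 of the W1b sequel over part 1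
`BalabanUVNodesN16Eq42PermutationDefect` (p593546) and part 2 `…Abelian` (p594757).  `--kind proof --supports stmt-QuantumFields-20544 --as helper`
(0 `def`: the symmetrised exponent and average are DISPLAYED sums, written out in each statement; K3⁷; count-neutral).  `bears_on: R4∕N16`.
RELATION TO lit-balaban's b12 leaves (cited, nothing restated): `B12ContourAverage253` types [I]'s contour family `𝐆(q,x)` as `permWord` (used here
BY NAME), Federbush's mean (0.10) and the averaged contour variables (0.11)∕the average (0.12) on the same CORNER cubes, and records the contour-PAIR
average (0.4) as NOT typed; `XhatSym` below is the common LINEARISATION of (0.4) and (0.12) (print's (0.8): the group average agrees with the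
arithmetic mean of the Lie-algebra elements to first order), written directly as a finite sum — no group average is needed at first order.

THE POINT.  [Balaban1987RG1] p. 252 replaces the single tree contour `Γ_{y,x}` of [Balaban1985Averaging] (42) by the FAMILY `G(y,x)` of broken lines
running the coordinates of `x − y` in EVERY order, averaged at BOTH ends of the transported bond independently ((0.4) p. 253:
`exp[Σ_x L^{−d} Σ_{Γ∈G(c₋,x)} |G|⁻¹ Σ_{Γ′∈G(c₊,x′)} |G|⁻¹ log U(Γ ∪ [x,x′] ∪ (−Γ′) ∪ (−c))]·U(c)`).  In the tree's word calculus on B7's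
CORNER blocks (lit-balaban's `permWord σ v` = the `σ`-ordered broken line) the LINEARISED exponent of that recipe is
  `(∑ r : Fin d → Fin L, (((L : ℝ) ^ d)⁻¹) • ((((Fintype.card (Equiv.Perm (Fin d)) : ℝ) ^ 2)⁻¹) •
        ∑ σ : Equiv.Perm (Fin d), ∑ σ' : Equiv.Perm (Fin d),
          asum A q (permWord σ (boxVec L r) ++ seg κ L ++ revWord (permWord σ' (boxVec L r)) ++ seg κ (-(L : ℤ))))) := Σ_r L^{−d} • |Sym|^{−2} • Σ_{σ,σ′} A(permWord σ v ++ [x,x′] ++ rev(permWord σ′ v) ++ (−c))`, `v = boxVec L r`   (§1).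
 * §2 ★★ **REYNOLDS IDENTITY**: `XhatSym[A](q,κ) = |Sym|⁻¹ • Σ_σ X̂[r_σA](r_{σ⁻¹} q, σ⁻¹κ)` (`XhatSym_eq_reynolds`) — the (0.4)-recipe's first-order exponent
   is the GROUP AVERAGE of the conjugates of (42)'s (the independent double average over `(σ, σ′)` collapses at the linear level: the
   far-end family is the translate of the near-end family, `XhatSym_sub_Xhat`); hence ★ `XhatSym_permCfg`: the recipe IS EXACTLY
   PERMUTATION-EQUIVARIANT, `XhatSym[r_τA](q,κ) = XhatSym[A](r_τ q, τκ)` — [Balaban1987RG1] p. 252 «preserving this symmetry is very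
   important for the method» as a kernel identity for the recipe (the tree's torus-typed (0.4) has it as `BlockAveraging.avgFun_permute`);
 * §3 ★ `XhatSym_eq_Xhat_of_const_flux`: at CONSTANT CURVATURE (circulations in the planes `(m, κ)` independent of the base point) the recipe and
   (42) AGREE at first order; ★ `norm_XhatSym_sub_Xhat_le`: for `δ`-Lipschitz circulations `‖XhatSym − X̂‖ ≤ d(d+2)·L³·δ` (part 1's bounds averaged);
 * §4 (commutative complete normed `ℂ`-algebra) the symmetrised ABELIAN average `exp(XhatSym[A] + A(Γ_c))` — for `W = exp ∘ A` (42) is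
   `exp(X̂ + A(Γ_c))` (`AbelianBlockAverage.bavg_expUnit'`) — agrees with (42) at constant curvature (`bavgSym_eq_bavg_of_const_flux`) and differs from it
   by the RELATIVE amount `e^{d(d+2)L³δ} − 1` on Lipschitz-flux fields (`norm_bavgSym_sub_bavg_le`).

READING FOR N16 (honest).  This is the first-order content of the located pin (42) ↔ (0.4) (p584628 `Transfer42to04 ∕ Transfer04to42`, displayed
hypotheses): the two recipes differ by a Reynolds-averaged lattice-derivative term, ZERO at constant curvature and `O(d²L³·c·η³)` on a level-`j` field
of [B11]-Thm-1 TYPE regularity (flux Lipschitz constant `cη³`), against the averages' own first-order term `O(dL²·b·η²)`.  CAVEATS (said plainly):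
(i) B7's CORNER blocks, not [I]'s CENTRED blocks (`|n_μ| ≤ (L−1)∕2`); (ii) the LINEARISED ∕ ABELIAN level only; (iii) the tree's (0.4) OBJECT is
`BlockAveraging.blockAvg expMeanLogSU` on torus types (`Node00.avOfRecord`) and is NOT bridged here — the displayed sums are the recipe written in B7's
`ℤᵈ` word calculus; (iv) nothing here proves the transfer of MINIMISER statements (different constraint manifolds).

HONEST FRAMING.  [folklore] bookkeeping over parts 1–2 and `AbelianBlockAverage` BY NAME; 0 `def`, 0 `sorry`; no printed
sentence is a hypothesis; nothing of [Balaban1985Averaging] ∕ [Balaban1987RG1] asserted beyond what the tree proves; no minimiser, no variational problem;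
`stub_h7` NOT closed; N16 ∕ NE3 NOT discharged; count-neutral (typed 28∕28 · discharged 5∕27 unmoved).  One finite four-torus programme at fixed `ε` — the
Yang–Mills mass gap (Clay) is NOT proved by any of this; R4 closes the conditional finite-𝕋⁴ rung `BalabanLadder.UV` only; nothing continuum ∕ ℝ⁴ ∕ OS.
-/

set_option autoImplicit false

open scoped BigOperators
open NormedSpace Finset

namespace Summit.QuantumFields.YangMills.BalabanUVNodes.N16Eq42VsSymmetrisedLinear

open Literature.MathematicalPhysics.QuantumFieldTheory.Balaban1983to89
open B7Prop1Explicit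
open B12Average012Permutation (permSite permCfg permCfg_apply permSite_mul permSite_one permSite_sub)
open B12ContourAverage253 (permWord disp_permWord)
open Summit.QuantumFields.BalabanUV.T4Continuum.AbelianBlockAverage (bavg_expUnit')
open Summit.QuantumFields.YangMills.BalabanUVNodes.N16Eq42PermutationDefect
open Summit.QuantumFields.YangMills.BalabanUVNodes.N16Eq42PermutationDefectAbelian (norm_exp_sub_exp_le)

noncomputable section

variable {d : ℕ}

/-- Finite double means against a constant: if `T σ σ′ − T₀ = f σ − g σ′` then `|S|^{−2} • Σ_{σ,σ′} T σ σ′ − T₀ = |S|⁻¹ • Σ_σ (f σ − g σ)` — the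
independent double average of a «near-end minus far-end» quantity collapses to a single average. [folklore] -/
theorem doubleMean_sub_const {S : Type*} [Fintype S] [Nonempty S] {M : Type*} [AddCommGroup M] [Module ℝ M]
    (T : S → S → M) (T₀ : M) (f g : S → M) (hT : ∀ σ σ', T σ σ' - T₀ = f σ - g σ') :
    (((Fintype.card S : ℝ) ^ 2)⁻¹) • (∑ σ, ∑ σ', T σ σ') - T₀
      = ((Fintype.card S : ℝ)⁻¹) • ∑ σ, (f σ - g σ) := by
  set N : ℝ := (Fintype.card S : ℝ) with hN
  have hN0 : N ≠ 0 := by rw [hN]; exact_mod_cast Fintype.card_ne_zero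
  have hsumN : ∀ x : M, ∑ _σ : S, x = N • x := fun x => by
    rw [Finset.sum_const, Finset.card_univ, ← Nat.cast_smul_eq_nsmul ℝ, hN]
  have h1 : ∑ σ, ∑ σ', T σ σ' = ∑ σ, ∑ σ', (T₀ + (f σ - g σ')) := by
    refine Finset.sum_congr rfl fun σ _ => Finset.sum_congr rfl fun σ' _ => ?_
    rw [← hT]; abel
  have h2 : ∑ σ : S, ∑ σ' : S, (T₀ + (f σ - g σ')) = (N * N) • T₀ + (N • ∑ σ, f σ - N • ∑ σ, g σ) := by
    have inner : ∀ σ : S, ∑ σ' : S, (T₀ + (f σ - g σ')) = N • T₀ + (N • f σ - ∑ σ', g σ') := fun σ => by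
      rw [Finset.sum_add_distrib, Finset.sum_sub_distrib, hsumN, hsumN]
    simp_rw [inner]
    rw [Finset.sum_add_distrib, Finset.sum_sub_distrib, hsumN, hsumN, ← Finset.smul_sum, smul_smul]
  rw [h1, h2, smul_add, smul_smul, show (N ^ 2)⁻¹ * (N * N) = 1 by field_simp, one_smul, add_sub_cancel_left,
    ← smul_sub, smul_smul, show (N ^ 2)⁻¹ * N = N⁻¹ by field_simp, ← Finset.sum_sub_distrib]

section Linear

variable {𝔸 : Type*} [NormedRing 𝔸] [NormedAlgebra ℂ 𝔸]

/-! ## §1 The (0.4)-shaped symmetrised linear exponent on corner blocks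

Throughout, «`XhatSym[A](q,κ)`» in the docstrings denotes the DISPLAYED finite sum
`Σ_r L^{−d} • |Sym|^{−2} • Σ_{σ,σ′} A(permWord σ v ++ seg κ L ++ revWord (permWord σ′ v) ++ seg κ (−L))`, `v = boxVec L r` — the (0.4)-shaped
symmetrised first-order exponent (block mean × independent double mean over the axis orders of the circulation around
`Γ^σ_{c₋,x} ∪ [x,x′] ∪ (−Γ^{σ′}_{c₊,x′}) ∪ (−c)`); it is written out in every statement (no `def`: proof-lane file). -/

omit [NormedAlgebra ℂ 𝔸] in
/-- Two-ended version of part 1's `asum_contour_sub`: contour sums built on near-end words `w₁ ∕ w₂` and far-end words `w₁′ ∕ w₂′`, all with the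
same displacement, differ by `(A w₁ − A w₂)(p) − (A w₁′ − A w₂′)(p + L e_κ)`. [folklore] -/
theorem asum_contour_sub₂ (A : Site d → Fin d → 𝔸) (p : Site d) (κ : Fin d) (L : ℕ) {w₁ w₁' w₂ w₂' : List (Letter d)}
    (h₁ : disp w₁' = disp w₁) (h₂ : disp w₂ = disp w₁) (h₂' : disp w₂' = disp w₁) :
    asum A p (w₁ ++ seg κ L ++ revWord w₁' ++ seg κ (-(L : ℤ))) - asum A p (w₂ ++ seg κ L ++ revWord w₂' ++ seg κ (-(L : ℤ)))
      = (asum A p w₁ - asum A p w₂)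
        - (asum A (p + (L : ℤ) • e κ) w₁' - asum A (p + (L : ℤ) • e κ) w₂') := by
  have e₁ : asum A (p + (disp w₁ + (L : ℤ) • e κ)) (revWord w₁') = -asum A (p + (L : ℤ) • e κ) w₁' :=
    asum_revWord' A _ _ (by rw [h₁]; abel)
  have e₂ : asum A (p + (disp w₂ + (L : ℤ) • e κ)) (revWord w₂') = -asum A (p + (L : ℤ) • e κ) w₂' :=
    asum_revWord' A _ _ (by rw [h₂', h₂]; abel)
  simp only [asum_append, disp_append, disp_seg, disp_revWord]
  rw [e₁, e₂, h₁, h₂, h₂']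
  abel

/-! ## §2 The Reynolds identity and exact equivariance -/

/-- **THE DOUBLE AVERAGE COLLAPSES**: `XhatSym − X̂ = Σ_r L^{−d} • |Sym|⁻¹ • Σ_σ [D^σ_v(q) − D^σ_v(q + L e_κ)]`, `D^σ_v(p) = A(permWord σ v from p) −
A(treeWord v from p)` — the far-end family of contours is the translate of the near-end family, so the independent `(σ, σ′)`-average of the
recipe reduces to a single average of part 1's closed-loop circulation differences. [folklore] -/
theorem XhatSym_sub_Xhat (L : ℕ) (A : Site d → Fin d → 𝔸) (q : Site d) (κ : Fin d) :
    (∑ r : Fin d → Fin L, (((L : ℝ) ^ d)⁻¹) • ((((Fintype.card (Equiv.Perm (Fin d)) : ℝ) ^ 2)⁻¹) •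
        ∑ σ : Equiv.Perm (Fin d), ∑ σ' : Equiv.Perm (Fin d),
          asum A q (permWord σ (boxVec L r) ++ seg κ L ++ revWord (permWord σ' (boxVec L r)) ++ seg κ (-(L : ℤ))))) - Xhat L A q κ
      = ∑ r : Fin d → Fin L, (((L : ℝ) ^ d)⁻¹) • ((((Fintype.card (Equiv.Perm (Fin d)) : ℝ))⁻¹) •
          ∑ σ : Equiv.Perm (Fin d),
            ((asum A q (permWord σ (boxVec L r)) - asum A q (treeWord (boxVec L r)))
              - (asum A (q + (L : ℤ) • e κ) (permWord σ (boxVec L r)) - asum A (q + (L : ℤ) • e κ) (treeWord (boxVec L r))))) := by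
  unfold Xhat
  rw [← Finset.sum_sub_distrib]
  refine Finset.sum_congr rfl fun r _ => ?_
  rw [← smul_sub]
  congr 1
  refine doubleMean_sub_const _ _ _ _ fun σ σ' => ?_
  rw [gammaWord]
  exact asum_contour_sub₂ A q κ L (by rw [disp_permWord, disp_permWord]) (by rw [disp_treeWord, disp_permWord])
    (by rw [disp_treeWord, disp_permWord])

/-- **★★ THE REYNOLDS IDENTITY**: the symmetrised first-order exponent is the GROUP AVERAGE over the axis permutations of the conjugates of
(42)'s: `(∑ r : Fin d → Fin L, (((L : ℝ) ^ d)⁻¹) • ((((Fintype.card (Equiv.Perm (Fin d)) : ℝ) ^ 2)⁻¹) •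
        ∑ σ : Equiv.Perm (Fin d), ∑ σ' : Equiv.Perm (Fin d),
          asum A q (permWord σ (boxVec L r) ++ seg κ L ++ revWord (permWord σ' (boxVec L r)) ++ seg κ (-(L : ℤ))))) = |Sym|⁻¹ • Σ_σ X̂[r_σA](r_{σ⁻¹} q, σ⁻¹ κ)` (part 1's exact defect identity `Xhat_permCfg_sub` summed over `σ`).
[cite: Balaban1987RG1, p.252, (0.4) p.253] -/
theorem XhatSym_eq_reynolds (L : ℕ) (A : Site d → Fin d → 𝔸) (q : Site d) (κ : Fin d) :
    (∑ r : Fin d → Fin L, (((L : ℝ) ^ d)⁻¹) • ((((Fintype.card (Equiv.Perm (Fin d)) : ℝ) ^ 2)⁻¹) •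
        ∑ σ : Equiv.Perm (Fin d), ∑ σ' : Equiv.Perm (Fin d),
          asum A q (permWord σ (boxVec L r) ++ seg κ L ++ revWord (permWord σ' (boxVec L r)) ++ seg κ (-(L : ℤ))))) = (((Fintype.card (Equiv.Perm (Fin d)) : ℝ))⁻¹) •
      ∑ σ : Equiv.Perm (Fin d), Xhat L (permCfg σ A) (permSite σ⁻¹ q) (σ⁻¹ κ) := by
  have hN : (Fintype.card (Equiv.Perm (Fin d)) : ℝ) ≠ 0 := by exact_mod_cast Fintype.card_ne_zero
  -- each conjugate of (42)'s exponent minus (42)'s exponent is part 1's defect sum, read at `(r_σ⁻¹ q, σ⁻¹ κ)`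
  have hdef : ∀ σ : Equiv.Perm (Fin d), Xhat L (permCfg σ A) (permSite σ⁻¹ q) (σ⁻¹ κ) - Xhat L A q κ
      = ∑ r : Fin d → Fin L, (((L : ℝ) ^ d)⁻¹) •
          ((asum A q (permWord σ (boxVec L r)) - asum A q (treeWord (boxVec L r)))
            - (asum A (q + (L : ℤ) • e κ) (permWord σ (boxVec L r)) - asum A (q + (L : ℤ) • e κ) (treeWord (boxVec L r)))) := by
    intro σ
    have h := Xhat_permCfg_sub L σ A (permSite σ⁻¹ q) (σ⁻¹ κ)
    have hq : permSite σ (permSite σ⁻¹ q) = q := by rw [← permSite_mul, mul_inv_cancel, permSite_one]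
    have hκ : σ (σ⁻¹ κ) = κ := σ.apply_symm_apply κ
    rw [hq, hκ] at h
    exact h
  -- sum over σ and compare with `XhatSym_sub_Xhat`
  have hsum : (((Fintype.card (Equiv.Perm (Fin d)) : ℝ))⁻¹) • ∑ σ : Equiv.Perm (Fin d), Xhat L (permCfg σ A) (permSite σ⁻¹ q) (σ⁻¹ κ)
      - Xhat L A q κ
      = (((Fintype.card (Equiv.Perm (Fin d)) : ℝ))⁻¹) •
          ∑ σ : Equiv.Perm (Fin d), (Xhat L (permCfg σ A) (permSite σ⁻¹ q) (σ⁻¹ κ) - Xhat L A q κ) := by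
    rw [Finset.sum_sub_distrib, Finset.sum_const, Finset.card_univ, smul_sub, ← Nat.cast_smul_eq_nsmul ℝ, smul_smul,
      inv_mul_cancel₀ hN, one_smul]
  have key : (∑ r : Fin d → Fin L, (((L : ℝ) ^ d)⁻¹) • ((((Fintype.card (Equiv.Perm (Fin d)) : ℝ) ^ 2)⁻¹) •
        ∑ σ : Equiv.Perm (Fin d), ∑ σ' : Equiv.Perm (Fin d),
          asum A q (permWord σ (boxVec L r) ++ seg κ L ++ revWord (permWord σ' (boxVec L r)) ++ seg κ (-(L : ℤ))))) - Xhat L A q κ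
      = (((Fintype.card (Equiv.Perm (Fin d)) : ℝ))⁻¹) • ∑ σ : Equiv.Perm (Fin d), Xhat L (permCfg σ A) (permSite σ⁻¹ q) (σ⁻¹ κ)
        - Xhat L A q κ := by
    rw [hsum, XhatSym_sub_Xhat]
    simp_rw [hdef, Finset.smul_sum, smul_smul]
    rw [Finset.sum_comm]
    refine Finset.sum_congr rfl fun σ _ => Finset.sum_congr rfl fun r _ => ?_
    rw [mul_comm]
  exact sub_left_inj.mp key

omit [NormedRing 𝔸] [NormedAlgebra ℂ 𝔸] in
/-- Relabelling twice: `r_σ(r_τ A) = r_{τσ} A` (lit-balaban's `permSite_mul`). [folklore] -/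
theorem permCfg_permCfg (σ τ : Equiv.Perm (Fin d)) (A : Site d → Fin d → 𝔸) :
    permCfg σ (permCfg τ A) = permCfg (τ * σ) A := by
  funext x μ
  simp only [permCfg_apply, permSite_mul, Equiv.Perm.mul_apply]

/-- **★ THE SYMMETRISED RECIPE IS EXACTLY PERMUTATION-EQUIVARIANT**: `XhatSym[r_τA](q,κ) = XhatSym[A](r_τ q, τκ)` — from the
Reynolds form by the reindexing `σ ↦ τσ` of the group average ([Balaban1987RG1] p. 252 «Preserving this symmetry is very important for the
method»; the torus-typed (0.4) has it as `BlockAveraging.avgFun_permute`). [cite: Balaban1987RG1, p.252, (2.17) p.269] -/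
theorem XhatSym_permCfg (L : ℕ) (τ : Equiv.Perm (Fin d)) (A : Site d → Fin d → 𝔸) (q : Site d) (κ : Fin d) :
    (∑ r : Fin d → Fin L, (((L : ℝ) ^ d)⁻¹) • ((((Fintype.card (Equiv.Perm (Fin d)) : ℝ) ^ 2)⁻¹) •
        ∑ σ : Equiv.Perm (Fin d), ∑ σ' : Equiv.Perm (Fin d),
          asum (permCfg τ A) q (permWord σ (boxVec L r) ++ seg κ L ++ revWord (permWord σ' (boxVec L r)) ++ seg κ (-(L : ℤ))))) = (∑ r : Fin d → Fin L, (((L : ℝ) ^ d)⁻¹) • ((((Fintype.card (Equiv.Perm (Fin d)) : ℝ) ^ 2)⁻¹) •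
        ∑ σ : Equiv.Perm (Fin d), ∑ σ' : Equiv.Perm (Fin d),
          asum A (permSite τ q) (permWord σ (boxVec L r) ++ seg (τ κ) L ++ revWord (permWord σ' (boxVec L r)) ++ seg (τ κ) (-(L : ℤ))))) := by
  rw [XhatSym_eq_reynolds, XhatSym_eq_reynolds]
  congr 1
  -- reindex the group average by left multiplication with `τ`
  refine Fintype.sum_equiv (Equiv.mulLeft τ) _ _ fun σ => ?_
  have h1 : permSite (τ * σ)⁻¹ (permSite τ q) = permSite σ⁻¹ q := by
    rw [← permSite_mul, mul_inv_rev, inv_mul_cancel_right]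
  have h2 : (τ * σ)⁻¹ (τ κ) = σ⁻¹ κ := by
    rw [mul_inv_rev, Equiv.Perm.mul_apply, show τ⁻¹ (τ κ) = κ from τ.symm_apply_apply κ]
  rw [Equiv.coe_mulLeft, h1, h2, permCfg_permCfg]

/-! ## §3 Constant curvature: the recipes agree.  Lipschitz flux: they differ by `O(L³δ)` -/

/-- **★ AT CONSTANT CURVATURE THE SYMMETRISED RECIPE AND (42) AGREE AT FIRST ORDER**: if the plaquette circulations of `A` in the planes `(m, κ)`
do not depend on the base point, `(∑ r : Fin d → Fin L, (((L : ℝ) ^ d)⁻¹) • ((((Fintype.card (Equiv.Perm (Fin d)) : ℝ) ^ 2)⁻¹) •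
        ∑ σ : Equiv.Perm (Fin d), ∑ σ' : Equiv.Perm (Fin d),
          asum A q (permWord σ (boxVec L r) ++ seg κ L ++ revWord (permWord σ' (boxVec L r)) ++ seg κ (-(L : ℤ))))) = X̂ L A q κ` (each conjugate in the Reynolds average equals `X̂` by part 1's
`Xhat_permCfg_of_const_flux`). [folklore] -/
theorem XhatSym_eq_Xhat_of_const_flux (L : ℕ) (hL : 1 ≤ L) (A : Site d → Fin d → 𝔸) (q : Site d) (κ : Fin d) (f : Fin d → 𝔸)
    (hf : ∀ (p : Site d) (m : Fin d), asum A p (plaqWord m κ) = f m) : (∑ r : Fin d → Fin L, (((L : ℝ) ^ d)⁻¹) • ((((Fintype.card (Equiv.Perm (Fin d)) : ℝ) ^ 2)⁻¹) •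
        ∑ σ : Equiv.Perm (Fin d), ∑ σ' : Equiv.Perm (Fin d),
          asum A q (permWord σ (boxVec L r) ++ seg κ L ++ revWord (permWord σ' (boxVec L r)) ++ seg κ (-(L : ℤ))))) = Xhat L A q κ := by
  have hN : (Fintype.card (Equiv.Perm (Fin d)) : ℝ) ≠ 0 := by exact_mod_cast Fintype.card_ne_zero
  have hterm : ∀ σ : Equiv.Perm (Fin d), Xhat L (permCfg σ A) (permSite σ⁻¹ q) (σ⁻¹ κ) = Xhat L A q κ := by
    intro σ
    have hκ : σ (σ⁻¹ κ) = κ := σ.apply_symm_apply κ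
    have h := Xhat_permCfg_of_const_flux L hL σ A (permSite σ⁻¹ q) (σ⁻¹ κ) f (by rw [hκ]; exact hf)
    rwa [← permSite_mul, mul_inv_cancel, permSite_one, hκ] at h
  rw [XhatSym_eq_reynolds]
  simp_rw [hterm]
  rw [Finset.sum_const, Finset.card_univ, ← Nat.cast_smul_eq_nsmul ℝ, smul_smul, inv_mul_cancel₀ hN, one_smul]

/-- **★ LIPSCHITZ FLUX ⇒ THE RECIPES DIFFER BY `O(L³δ)`**: if the circulations of `A` in the planes `(m, κ)` are `δ`-Lipschitz in the base point within
`(d+2)L` of `q`, then `‖(∑ r : Fin d → Fin L, (((L : ℝ) ^ d)⁻¹) • ((((Fintype.card (Equiv.Perm (Fin d)) : ℝ) ^ 2)⁻¹) •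
        ∑ σ : Equiv.Perm (Fin d), ∑ σ' : Equiv.Perm (Fin d),
          asum A q (permWord σ (boxVec L r) ++ seg κ L ++ revWord (permWord σ' (boxVec L r)) ++ seg κ (-(L : ℤ))))) − X̂ L A q κ‖ ≤ d(d+2)·L³·δ` (the Reynolds average of part 1's `norm_Xhat_permCfg_sub_le`; every conjugate is
compared at the SAME point `q` and direction `κ`, so one Lipschitz hypothesis serves all `σ`). [folklore] -/
theorem norm_XhatSym_sub_Xhat_le (L : ℕ) (hL : 1 ≤ L) (A : Site d → Fin d → 𝔸) (q : Site d) (κ : Fin d) {δ : ℝ} (hδ0 : 0 ≤ δ)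
    (hδ : ∀ (p : Site d) (m : Fin d), l1 (p - q) ≤ (d + 2) * L →
      ‖asum A p (plaqWord m κ) - asum A q (plaqWord m κ)‖ ≤ δ * l1 (p - q)) :
    ‖(∑ r : Fin d → Fin L, (((L : ℝ) ^ d)⁻¹) • ((((Fintype.card (Equiv.Perm (Fin d)) : ℝ) ^ 2)⁻¹) •
        ∑ σ : Equiv.Perm (Fin d), ∑ σ' : Equiv.Perm (Fin d),
          asum A q (permWord σ (boxVec L r) ++ seg κ L ++ revWord (permWord σ' (boxVec L r)) ++ seg κ (-(L : ℤ))))) - Xhat L A q κ‖ ≤ d * (d + 2) * (L : ℝ) ^ 3 * δ := by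
  set N : ℝ := (Fintype.card (Equiv.Perm (Fin d)) : ℝ) with hNdef
  have hN : N ≠ 0 := by rw [hNdef]; exact_mod_cast Fintype.card_ne_zero
  have hNpos : 0 < N := by rw [hNdef]; exact_mod_cast Fintype.card_pos
  have hterm : ∀ σ : Equiv.Perm (Fin d),
      ‖Xhat L (permCfg σ A) (permSite σ⁻¹ q) (σ⁻¹ κ) - Xhat L A q κ‖ ≤ d * (d + 2) * (L : ℝ) ^ 3 * δ := by
    intro σ
    have hκ : σ (σ⁻¹ κ) = κ := σ.apply_symm_apply κ
    have hq : permSite σ (permSite σ⁻¹ q) = q := by rw [← permSite_mul, mul_inv_cancel, permSite_one]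
    have h := norm_Xhat_permCfg_sub_le L hL σ A (permSite σ⁻¹ q) (σ⁻¹ κ) hδ0 (by rw [hq, hκ]; exact hδ)
    rwa [hq, hκ] at h
  have hrew : (∑ r : Fin d → Fin L, (((L : ℝ) ^ d)⁻¹) • ((((Fintype.card (Equiv.Perm (Fin d)) : ℝ) ^ 2)⁻¹) •
        ∑ σ : Equiv.Perm (Fin d), ∑ σ' : Equiv.Perm (Fin d),
          asum A q (permWord σ (boxVec L r) ++ seg κ L ++ revWord (permWord σ' (boxVec L r)) ++ seg κ (-(L : ℤ))))) - Xhat L A q κ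
      = N⁻¹ • ∑ σ : Equiv.Perm (Fin d), (Xhat L (permCfg σ A) (permSite σ⁻¹ q) (σ⁻¹ κ) - Xhat L A q κ) := by
    rw [XhatSym_eq_reynolds, Finset.sum_sub_distrib, Finset.sum_const, Finset.card_univ, smul_sub, ← Nat.cast_smul_eq_nsmul ℝ,
      smul_smul, ← hNdef, inv_mul_cancel₀ hN, one_smul]
  rw [hrew, norm_smul, norm_inv, Real.norm_of_nonneg hNpos.le]
  calc N⁻¹ * ‖∑ σ : Equiv.Perm (Fin d), (Xhat L (permCfg σ A) (permSite σ⁻¹ q) (σ⁻¹ κ) - Xhat L A q κ)‖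
      ≤ N⁻¹ * ∑ σ : Equiv.Perm (Fin d), ‖Xhat L (permCfg σ A) (permSite σ⁻¹ q) (σ⁻¹ κ) - Xhat L A q κ‖ :=
        mul_le_mul_of_nonneg_left (norm_sum_le _ _) (by positivity)
    _ ≤ N⁻¹ * ∑ _σ : Equiv.Perm (Fin d), d * (d + 2) * (L : ℝ) ^ 3 * δ :=
        mul_le_mul_of_nonneg_left (Finset.sum_le_sum fun σ _ => hterm σ) (by positivity)
    _ = d * (d + 2) * (L : ℝ) ^ 3 * δ := by
        rw [Finset.sum_const, Finset.card_univ, nsmul_eq_mul, ← hNdef]; field_simp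

end Linear

/-! ## §4 The symmetrised ABELIAN average against (42) -/

section Comm

variable {𝔸 : Type*} [NormedCommRing 𝔸] [NormedAlgebra ℂ 𝔸] [CompleteSpace 𝔸]

/-- **★ AT CONSTANT CURVATURE THE TWO ABELIAN AVERAGES COINCIDE**: the symmetrised abelian average `exp(XhatSym[A]_c + A(Γ_c))` EQUALS (42)'s `bavg L (exp ∘ A) c` when the circulations of `A` in the planes
`(m, κ)` are constant and (42)'s loop variables lie in the ball of the logarithm (flux bound `dL²φ < log 2`). [folklore] -/
theorem bavgSym_eq_bavg_of_const_flux (L : ℕ) (hL : 1 ≤ L) (A : Site d → Fin d → 𝔸) (q : Site d) (κ : Fin d) (f : Fin d → 𝔸)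
    (hf : ∀ (p : Site d) (m : Fin d), asum A p (plaqWord m κ) = f m) {φ : ℝ} (hφ0 : 0 ≤ φ)
    (hφ : ∀ (p : Site d) (m : Fin d), ‖asum A p (plaqWord m κ)‖ ≤ φ) (hφL : d * (L : ℝ) ^ 2 * φ < Real.log 2) :
    expUnit ((∑ r : Fin d → Fin L, (((L : ℝ) ^ d)⁻¹) • ((((Fintype.card (Equiv.Perm (Fin d)) : ℝ) ^ 2)⁻¹) •
        ∑ σ : Equiv.Perm (Fin d), ∑ σ' : Equiv.Perm (Fin d),
          asum A q (permWord σ (boxVec L r) ++ seg κ L ++ revWord (permWord σ' (boxVec L r)) ++ seg κ (-(L : ℤ))))) + asum A q (seg κ L)) = bavg L (fun y μ => expUnit (A y μ)) q κ := by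
  rw [XhatSym_eq_Xhat_of_const_flux L hL A q κ f hf, bavg_expUnit' L hL A q κ (loop_small_of_flux L A q κ hφ0 hφ hφL)]

/-- **★ LIPSCHITZ FLUX: THE TWO ABELIAN AVERAGES DIFFER BY THE RELATIVE AMOUNT `e^{d(d+2)L³δ} − 1`**:
`‖exp(XhatSym[A]_c + A(Γ_c)) − V̄_c‖ ≤ ‖V̄_c‖·(e^{d(d+2)L³δ} − 1)` for `V̄ = bavg L (exp ∘ A)` inside the ball of the logarithm. [folklore] -/
theorem norm_bavgSym_sub_bavg_le (L : ℕ) (hL : 1 ≤ L) (A : Site d → Fin d → 𝔸) (q : Site d) (κ : Fin d) {φ : ℝ} (hφ0 : 0 ≤ φ)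
    (hφ : ∀ (p : Site d) (m : Fin d), ‖asum A p (plaqWord m κ)‖ ≤ φ) (hφL : d * (L : ℝ) ^ 2 * φ < Real.log 2) {δ : ℝ} (hδ0 : 0 ≤ δ)
    (hδ : ∀ (p : Site d) (m : Fin d), l1 (p - q) ≤ (d + 2) * L →
      ‖asum A p (plaqWord m κ) - asum A q (plaqWord m κ)‖ ≤ δ * l1 (p - q)) :
    ‖((expUnit ((∑ r : Fin d → Fin L, (((L : ℝ) ^ d)⁻¹) • ((((Fintype.card (Equiv.Perm (Fin d)) : ℝ) ^ 2)⁻¹) •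
        ∑ σ : Equiv.Perm (Fin d), ∑ σ' : Equiv.Perm (Fin d),
          asum A q (permWord σ (boxVec L r) ++ seg κ L ++ revWord (permWord σ' (boxVec L r)) ++ seg κ (-(L : ℤ))))) + asum A q (seg κ L)) : 𝔸ˣ) : 𝔸) - ((bavg L (fun y μ => expUnit (A y μ)) q κ : 𝔸ˣ) : 𝔸)‖
      ≤ ‖((bavg L (fun y μ => expUnit (A y μ)) q κ : 𝔸ˣ) : 𝔸)‖ * (Real.exp (d * (d + 2) * (L : ℝ) ^ 3 * δ) - 1) := by
  rw [bavg_expUnit' L hL A q κ (loop_small_of_flux L A q κ hφ0 hφ hφL), val_expUnit, val_expUnit]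
  refine (norm_exp_sub_exp_le _ _).trans (mul_le_mul_of_nonneg_left ?_ (norm_nonneg _))
  have h := norm_XhatSym_sub_Xhat_le L hL A q κ hδ0 hδ
  rw [add_sub_add_right_eq_sub]
  linarith [Real.exp_le_exp.mpr h]

end Comm

end

end Summit.QuantumFields.YangMills.BalabanUVNodes.N16Eq42VsSymmetrisedLinear
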